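import Summits.CriticalPhenomena.SAWScalingLimit.Theorems.SAWReversalUpgradeAttachReversalPrelimA
import Summits.CriticalPhenomena.SAWScalingLimit.Theorems.SAWReversalUpgradeAttachReversalPrelimC

/-!
# Attachment reversal, preliminaries B: the squeeze commutes with inversions; the pushed point

Helper file for item `AttachReversal` of route `SAWReversalUpgrade` (stmt-CriticalPhenomena-18007).
The angular squeeze `A_e z = |z| e^{i(e + (1 - 2e/π) arg z)}` (`AttachReversal.squeeze`, whose basic
properties are the tree's `sqz_*` lemmas of `SAWReversalUpgradeAttachmentExistsSqueeze`, fed with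
`squeeze_spec'` of PrelimC) COMMUTES with every inversion `ι_c z = -1/(c z)`, `c > 0` (`squeeze_negInv`) and with
dilations (`squeeze_real_mul`). Consequently the pushed point
`Z(w) = if w = b then b else Φ (A_e (ψ w))` of the route's attachment is the SAME for `(D; a, b, φ)` and
for the swapped data `(D; b, a, φ')` at every `w ∈ closure D` (`pushVal_swap`): the pointwise heart of
the reversal-equivariance of the attachment.
-/

noncomputable section

open Set Function Filter Topology Complex
open UpperHalfPlane (upperHalfPlaneSet)
open Literature.Probability.RandomPlanarGeometry

namespace Summit.CriticalPhenomena.SAWScalingLimit.Theorems.AttachReversal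

/-- `hinv Φ` is `invFunOn Φ ℍ̄` (definitional). -/
theorem hinv_apply (Φ : ℂ → ℂ) (w : ℂ) : hinv Φ w = invFunOn Φ {z : ℂ | 0 ≤ z.im} w := rfl

/-! ### Polar bookkeeping -/

/-- The squeeze in exponential polar form. -/
theorem squeeze_eq_polar (e : ℝ) (z : ℂ) :
    squeeze e z = ((‖z‖ : ℝ) : ℂ) * exp (((e + (1 - 2 * e / Real.pi) * arg z : ℝ) : ℂ) * I) := by
  rw [squeeze_spec' e z, sqz_exponent_eq]

/-- The argument of `r e^{ix}` is `x` for `r > 0`, `x ∈ (-π, π]`. -/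
theorem arg_real_mul_exp {r x : ℝ} (hr : 0 < r) (hx : x ∈ Ioc (-Real.pi) Real.pi) :
    arg ((r : ℂ) * exp ((x : ℂ) * I)) = x := by
  rw [Complex.exp_mul_I, arg_mul_cos_add_sin_mul_I hr hx]

/-- `-1/(r e^{ix}) = r⁻¹ e^{i(π - x)}`. -/
theorem negInv_real_mul_exp (r x : ℝ) :
    -((r : ℂ) * exp ((x : ℂ) * I))⁻¹ = ((r⁻¹ : ℝ) : ℂ) * exp (((Real.pi - x : ℝ) : ℂ) * I) := by
  push_cast
  rw [sub_mul, Complex.exp_sub, Complex.exp_pi_mul_I, mul_inv]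
  have h : exp ((x : ℂ) * I) ≠ 0 := Complex.exp_ne_zero _
  field_simp

/-- For `im z ≥ 0` the argument of `z` lies in `[0, π]`. -/
theorem arg_mem_Icc_of_im_nonneg {z : ℂ} (hz : 0 ≤ z.im) : arg z ∈ Icc 0 Real.pi :=
  ⟨arg_nonneg_iff.2 hz, arg_le_pi z⟩

/-- Polar form of the inversion: `-1/(c z) = (c|z|)⁻¹ e^{i(π - arg z)}`. -/
theorem negInv_eq_polar {c : ℝ} (z : ℂ) :
    -((c : ℂ) * z)⁻¹ = (((c * ‖z‖)⁻¹ : ℝ) : ℂ) * exp (((Real.pi - arg z : ℝ) : ℂ) * I) := by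
  conv_lhs => rw [← norm_mul_exp_arg_mul_I z]
  rw [← mul_assoc, ← Complex.ofReal_mul]
  exact negInv_real_mul_exp (c * ‖z‖) (arg z)

/-- `arg (-1/(c z)) = π - arg z` for `z ∈ ℍ̄ ∖ {0}`, `c > 0`. -/
theorem arg_negInv {c : ℝ} (hc : 0 < c) {z : ℂ} (hz : 0 ≤ z.im) (hz0 : z ≠ 0) :
    arg (-((c : ℂ) * z)⁻¹) = Real.pi - arg z := by
  rw [negInv_eq_polar]
  refine arg_real_mul_exp (inv_pos.2 (mul_pos hc (norm_pos_iff.2 hz0))) ?_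
  have h := arg_mem_Icc_of_im_nonneg hz
  constructor <;> linarith [h.1, h.2, Real.pi_pos]

/-! ### The squeeze commutes with inversions and dilations -/

/-- **`A_e` commutes with the inversions `ι_c z = -1/(c z)`** on `ℍ̄ ∖ {0}` (`c > 0`): the squeeze
acts on the angle by the affine map `θ ↦ e + (1 - 2e/π) θ`, which commutes with `θ ↦ π - θ`, and on
the modulus trivially. -/
theorem squeeze_negInv (e : ℝ) {c : ℝ} (hc : 0 < c) {z : ℂ} (hz : 0 ≤ z.im) (hz0 : z ≠ 0) :
    squeeze e (-((c : ℂ) * z)⁻¹) = -((c : ℂ) * squeeze e z)⁻¹ := by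
  rw [squeeze_eq_polar, arg_negInv hc hz hz0, norm_negInv hc, squeeze_eq_polar, ← mul_assoc,
    ← Complex.ofReal_mul, negInv_real_mul_exp]
  congr 3
  have hπ : Real.pi ≠ 0 := Real.pi_pos.ne'
  field_simp
  ring

/-- Dilations commute with the squeeze: `A_e (t z) = t A_e z` for `t > 0`. -/
theorem squeeze_real_mul (e : ℝ) {t : ℝ} (ht : 0 < t) (z : ℂ) :
    squeeze e ((t : ℂ) * z) = (t : ℂ) * squeeze e z := by
  rw [squeeze_eq_polar, squeeze_eq_polar, arg_real_mul z ht, norm_mul, Complex.norm_real,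
    Real.norm_of_nonneg ht.le]
  push_cast
  ring

/-! ### The pushed point is the same for `(D; a, b, φ)` and `(D; b, a, φ')` -/

variable {D : DobrushinDomain} {φ : ConformalEquiv upperHalfPlaneSet D.carrier}
  {φ' : ConformalEquiv upperHalfPlaneSet D.swap.carrier}

/-- **Reversal-equivariance of the pushed point.** For `w ∈ closure D`, the pushed point of the
attachment computed with the swapped data `(D; b, a, φ')` — `if w = a then a else Φ' (A_e (ψ' w))` —
equals the one computed with `(D; a, b, φ)` — `if w = b then b else Φ (A_e (ψ w))` — because
`ψ' = ι ∘ ψ`, `A_e ∘ ι = ι ∘ A_e`, `Φ' = Φ ∘ ι` and `ι ∘ ι = id`. -/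
theorem pushVal_swap (hφ : D.IsChordalUniformizing φ) (hφ' : D.swap.IsChordalUniformizing φ')
    {c : ℝ} (hc : 0 < c) (heq : ∀ z ∈ upperHalfPlaneSet, φ' z = φ (-((c : ℂ) * z)⁻¹))
    {e : ℝ} (he : 0 < e) (he' : e ≤ 1 / 2) {w : ℂ} (hw : w ∈ closure D.carrier) :
    @ite ℂ (w = D.pt 0) (Classical.propDecidable _) (D.pt 0)
        (φ'.boundaryExtension (squeeze e (hinv φ'.boundaryExtension w))) =
      @ite ℂ (w = D.pt 1) (Classical.propDecidable _) (D.pt 1)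
        (φ.boundaryExtension (squeeze e (hinv φ.boundaryExtension w))) := by
  have hab : D.pt 0 ≠ D.pt 1 := D.pt_injective.ne (by decide)
  by_cases hwa : w = D.pt 0
  · subst hwa
    rw [if_pos rfl, if_neg hab, hinv_apply, FaithfulAttach.invFun_pt_zero hφ, squeeze_zero,
      hφ.boundaryExtension_zero]
  rw [if_neg hwa]
  by_cases hwb : w = D.pt 1
  · subst hwb
    rw [if_pos rfl, hinv_apply, invFunOn_bExt_swap_pt_one hφ', squeeze_zero, bExt_swap_zero hφ']
  rw [if_neg hwb, hinv_apply, hinv_apply, invFunOn_bExt_swap_eq hφ hc heq hw hwa hwb]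
  set z := invFunOn φ.boundaryExtension {z : ℂ | 0 ≤ z.im} w with hz_def
  have hz : 0 ≤ z.im := (FaithfulAttach.invFun_spec hφ hw hwb).1
  have hz0 : z ≠ 0 := invFunOn_bExt_ne_zero hφ hw hwb hwa
  rw [squeeze_negInv e hc hz hz0]
  have hs : 0 < (squeeze e z).im := sqz_im_pos he he' (squeeze_spec' e) hz hz0
  have hs0 : squeeze e z ≠ 0 := by
    intro h; rw [h] at hs; simp at hs
  rw [bExt_swap_eq hc heq (negInv_im_nonneg hc hs.le) (negInv_ne_zero hc.ne' hs0),
    negInv_negInv hc.ne']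
where
  /-- `A_e 0 = 0`. -/
  squeeze_zero {e : ℝ} : squeeze e 0 = 0 := sqz_zero (squeeze_spec' e)

end Summit.CriticalPhenomena.SAWScalingLimit.Theorems.AttachReversal

end
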